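import Summits.Ventures.Crystal3D.Theorems.StickyWulffConstantTextureBuildLayerDescentLevel
import Summits.Ventures.Crystal3D.Theorems.StickyWulffConstantTextureLiminfCubeRigidity
import HarnessLib

/-!
# TB-1 brick L-PROP-5 (frame form): READ THE PRESENTATION OF A GRAIN FROM ANY CLOSE-PACKED BALL, in the frame of its shell, as far toward the wall as shells allow
# (lane T, crux `TextureLiminfV5`, stmt-Ventures-23912; memo HOME/wulff-p2/g25/SLAB-PLATES-g25.md §6–§7)

HONEST FRAMING. Venture `Summits/Ventures/Crystal3D` (cell `crystal3d-full`), route `route-Ventures-StickyWulffConstant`, helper `--supports` the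
law-v5 crux `TextureLiminfV5` (stmt-Ventures-23912).  Frame bookkeeping (census-free, standard axioms) over '…TextureBuildLayerDescentLevel'
(`exists_local_stacking_descent_shell`), with the frame taken from the ball's own shell as in `ballRigidity` ('…TextureLiminfCubeRigidity').  No cover is
built; F-C1 not moved.

WHY.  This is the near-wall presentation tool of the healed `stub_TB_cover` in its final, chart-free form: NO clearance hypothesis at all at the base (any
ball `b = x i₀` with a close-packed first shell), a frame `L` determined by that shell, and close-packed shells asked only level by level in the slab-cone that is
actually read (`|v₃ + m√(2/3)| ≤ 1`, `‖v‖ ≤ m + N m + 2` in the chart coordinates `v = L⁻¹(x c − b)`), so the caller can shape a staircase that hugs an inclined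
wall.  Output: a Hägg word `s` and the presentation `stacking L b s`, certified (every site a ball) on every level `M ≤ K + 1` down to radius `N M`, unless an
INCLINED-TWIN WITNESS (an HCP-arranged ball on an FCC-type level, located) occurs at a level `≤ M` — the coherent sub-grain boundary where this tent must stop.

* **`exists_frame_descent`** — the statement above.
-/

noncomputable section

namespace Summit.Ventures.Crystal3D.Theorems

open Literature.Geometry.DiscreteGeometry Literature.MathematicalPhysics.StatisticalMechanics
open RealInnerProductSpace Summit.Ventures.Crystal3D.L2B Summit.Ventures.Crystal3D.Theorems.LocalStacking
open Summit.Ventures.Crystal3D.Cruxes.TextureLiminf.TexShadow (stacking)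

variable {N₀ : ℕ} {x : Fin N₀ → EuclideanSpace ℝ (Fin 3)}

/-- **THE PRESENTATION READ FROM A CLOSE-PACKED BALL.**  See the module docstring. -/
theorem exists_frame_descent (hx : IsUnitPacking x) (i₀ : Fin N₀) (hcp0 : IsClosePackedShell x i₀) :
    ∃ (L : EuclideanSpace ℝ (Fin 3) ≃ₗᵢ[ℝ] EuclideanSpace ℝ (Fin 3)) (σ σ' : ℝ), (σ = 1 ∨ σ = -1) ∧ (σ' = 1 ∨ σ' = -1) ∧
      ∀ (N : ℕ → ℤ) (K : ℕ), (∀ m, m ≤ K + 1 → 2 ≤ N m) →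
      (∀ c : Fin N₀, ∀ m : ℕ, m ≤ K + 1 → |(L.symm (x c - x i₀)) 2 + m * Real.sqrt (2 / 3)| ≤ 1 →
        ‖L.symm (x c - x i₀)‖ ≤ m + N m + 2 → IsClosePackedShell x c) →
      ∃ s : ℤ → ℤ, IsHaggSeq s ∧ ∀ M : ℕ, M ≤ K + 1 →
        ¬ (σ' = -σ ∧ ∃ i j : ℤ, |i| + |j| ≤ N 0 + 1 ∧ ∃ c : Fin N₀,
            x c = L (barlowPos 1 (Real.sqrt (2 / 3)) s 0 i j) + x i₀ ∧ IsArrangedIn (contactShell x c) hcpKissingPattern) →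
        (¬ ∃ m : ℕ, 1 ≤ m ∧ m ≤ M ∧ s (-(m : ℤ) - 1) = s (-(m : ℤ)) ∧ ∃ i j : ℤ, |i| + |j| ≤ N m + 1 ∧ ∃ c : Fin N₀,
            x c = L (barlowPos 1 (Real.sqrt (2 / 3)) s (-(m : ℤ)) i j) + x i₀ ∧ IsArrangedIn (contactShell x c) hcpKissingPattern) →
        ∀ i j : ℤ, |i| + |j| ≤ N M → L (barlowPos 1 (Real.sqrt (2 / 3)) s (-(M : ℤ)) i j) + x i₀ ∈ Set.range x := by
  set b := x i₀ with hb
  set V : Set (EuclideanSpace ℝ (Fin 3)) := Set.range fun j => (2 : ℝ) • x j with hVdef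
  have hV : IsUnitBallPacking V := isUnitBallPacking_range_two_smul hx
  -- the frame of the shell of `b`
  have harr : IsArrangedIn (kissingShell V ((2 : ℝ) • b)) fccKissingPattern ∨ IsArrangedIn (kissingShell V ((2 : ℝ) • b)) hcpKissingPattern := by
    rw [hVdef, kissingShell_range_two_smul]; exact hcp0
  obtain ⟨L, hH⟩ : ∃ L : EuclideanSpace ℝ (Fin 3) ≃ₗᵢ[ℝ] EuclideanSpace ℝ (Fin 3), hexagonSet ⊆ L ⁻¹' kissingShell V ((2 : ℝ) • b) := by
    rcases harr with h | h
    · exact exists_frame_of_isArrangedIn_fcc h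
    · obtain ⟨L, hL, -⟩ := exists_frame_of_isArrangedIn_hcp h
      exact ⟨L, hL⟩
  set W : Set (EuclideanSpace ℝ (Fin 3)) := {y | (2 : ℝ) • b + L y ∈ V} with hWdef
  have hW : IsUnitBallPacking W := hV.preimage ((2 : ℝ) • b) L
  have hS0pre : kissingShell W 0 = L ⁻¹' kissingShell V ((2 : ℝ) • b) := by
    rw [hWdef, kissingShell_moved, map_zero, add_zero]
  have harrW : IsArrangedIn (kissingShell W 0) fccKissingPattern ∨ IsArrangedIn (kissingShell W 0) hcpKissingPattern := by
    rw [hS0pre]; exact harr.imp (fun h => h.preimage L) (fun h => h.preimage L)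
  obtain ⟨σ, σ', hσ, hσ', hS0⟩ := (isTwelveConfig_kissingShell_of_isArrangedIn hW harrW).eq_layerShell (by rw [hS0pre]; exact hH)
  have h0W : (0 : EuclideanSpace ℝ (Fin 3)) ∈ W := by
    show (2 : ℝ) • b + L 0 ∈ V
    rw [map_zero, add_zero]; exact ⟨i₀, rfl⟩
  refine ⟨L, σ, σ', hσ, hσ', fun N K hN2 hcp => ?_⟩
  -- frame bookkeeping (as in `descentPropagation`)
  have memW : ∀ y, y ∈ W ↔ ∃ c, (2 : ℝ) • x c = (2 : ℝ) • b + L y := fun y => by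
    simp only [hWdef, hVdef, Set.mem_setOf_eq, Set.mem_range]
  have halfW : ∀ {y : EuclideanSpace ℝ (Fin 3)} {c : Fin N₀}, (2 : ℝ) • x c = (2 : ℝ) • b + L y →
      x c - b = L ((2 : ℝ)⁻¹ • y) := by
    intro y c h
    have h2 : (2 : ℝ) • (x c - b) = L y := by rw [smul_sub, h]; abel
    rw [map_smul, ← h2, smul_smul]; norm_num
  have halfW' : ∀ {y : EuclideanSpace ℝ (Fin 3)} {c : Fin N₀}, (2 : ℝ) • x c = (2 : ℝ) • b + L y →
      L.symm (x c - b) = (2 : ℝ)⁻¹ • y := by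
    intro y c h; rw [halfW h, LinearIsometryEquiv.symm_apply_apply]
  have ballW : ∀ {y : EuclideanSpace ℝ (Fin 3)} {c : Fin N₀}, (2 : ℝ) • x c = (2 : ℝ) • b + L y →
      ∀ (s : ℤ → ℤ) (k i j : ℤ), y = barlowPos 2 layerSpacing s k i j → x c = L (barlowPos 1 (Real.sqrt (2 / 3)) s k i j) + b := by
    intro y c h s k i j hy
    have h1 := halfW h
    rw [hy, barlowPos_two_eq_two_smul, smul_smul, inv_mul_cancel₀ (two_ne_zero' ℝ), one_smul] at h1
    rw [← h1]; abel
  -- the slab-cone hypothesis in the frame, per level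
  have hcpW : ∀ u ∈ W, ∀ m : ℕ, m ≤ K + 1 → |u 2 + m * layerSpacing| ≤ 2 → ‖u‖ ≤ 2 * m + 2 * (N m) + 4 →
      IsArrangedIn (kissingShell W u) fccKissingPattern ∨ IsArrangedIn (kissingShell W u) hcpKissingPattern := by
    intro u hu m hm hu2 hun
    obtain ⟨c, hc⟩ := (memW u).1 hu
    have hshell : kissingShell W u = L ⁻¹' kissingShell V ((2 : ℝ) • x c) := by
      rw [hWdef, kissingShell_moved, ← hc]
    have hcp' : IsClosePackedShell x c := by
      refine hcp c m hm ?_ ?_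
      · rw [halfW' hc, PiLp.smul_apply, smul_eq_mul]
        have e : (2 : ℝ)⁻¹ * u 2 + m * Real.sqrt (2 / 3) = (2 : ℝ)⁻¹ * (u 2 + m * layerSpacing) := by
          rw [layerSpacing]; ring
        rw [e, abs_mul, abs_of_pos (by norm_num : (0 : ℝ) < 2⁻¹)]
        linarith
      · rw [halfW' hc, norm_smul, Real.norm_of_nonneg (by norm_num)]
        have : ((N m : ℤ) : ℝ) = (N m : ℝ) := rfl
        linarith
    rw [hshell, hVdef, kissingShell_range_two_smul]
    exact hcp'.imp (fun h => h.preimage L) (fun h => h.preimage L)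
  -- translate an in-frame HCP-arranged witness to the labelled packing
  have witness : ∀ (s : ℤ → ℤ) (k i j : ℤ), barlowPos 2 layerSpacing s k i j ∈ W →
      IsArrangedIn (kissingShell W (barlowPos 2 layerSpacing s k i j)) hcpKissingPattern →
      ∃ c : Fin N₀, x c = L (barlowPos 1 (Real.sqrt (2 / 3)) s k i j) + b ∧ IsArrangedIn (contactShell x c) hcpKissingPattern := by
    intro s k i j hmem harr'
    obtain ⟨c, hc⟩ := (memW _).1 hmem
    refine ⟨c, ballW hc s _ _ _ rfl, ?_⟩
    have hshell : kissingShell W (barlowPos 2 layerSpacing s k i j) = L ⁻¹' kissingShell V ((2 : ℝ) • x c) := by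
      rw [hWdef, kissingShell_moved, ← hc]
    rw [hshell, hVdef, kissingShell_range_two_smul] at harr'
    have h := harr'.preimage L.symm
    have e : L.symm ⁻¹' (L ⁻¹' contactShell x c) = contactShell x c := by
      ext z; simp
    rwa [e] at h
  -- run the descent and undo the frame
  obtain ⟨s, hs, hdesc⟩ := exists_local_stacking_descent_shell hW hσ hσ' h0W hS0 N K hN2 hcpW
  refine ⟨s, hs, fun M hM hnow0 hnow i j hij => ?_⟩
  have hnow0' : ¬ (σ' = -σ ∧ ∃ i j : ℤ, |i| + |j| ≤ N 0 + 1 ∧ barlowPos 2 layerSpacing s 0 i j ∈ W ∧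
      IsArrangedIn (kissingShell W (barlowPos 2 layerSpacing s 0 i j)) hcpKissingPattern) := by
    rintro ⟨hneg, i', j', hij', hmem, harr'⟩
    exact hnow0 ⟨hneg, i', j', hij', witness s 0 i' j' hmem harr'⟩
  have hnow' : ¬ ∃ m : ℕ, 1 ≤ m ∧ m ≤ M ∧ s (-(m : ℤ) - 1) = s (-(m : ℤ)) ∧ ∃ i j : ℤ, |i| + |j| ≤ N m + 1 ∧
      barlowPos 2 layerSpacing s (-(m : ℤ)) i j ∈ W ∧
      IsArrangedIn (kissingShell W (barlowPos 2 layerSpacing s (-(m : ℤ)) i j)) hcpKissingPattern := by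
    rintro ⟨m, hm1, hmM, htyp, i', j', hij', hmem, harr'⟩
    exact hnow ⟨m, hm1, hmM, htyp, i', j', hij', witness s _ i' j' hmem harr'⟩
  obtain ⟨c, hc⟩ := (memW _).1 (hdesc M hM hnow0' hnow' i j hij)
  exact ⟨c, ballW hc s _ _ _ rfl⟩

end Summit.Ventures.Crystal3D.Theorems

end
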